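import Literature.NumberTheory.EllipticCurves.FrobeniusManinProofs
import Literature.NumberTheory.EllipticCurves.FrobeniusTateModule
import Literature.NumberTheory.EllipticCurves.ZetaEllipticCurveFiniteField
import HarnessLib

/-!
# Hasse–Weil for elliptic curves over finite fields (Silverman V.2.3.1(a)) — discharged

Topic `NumberTheory/EllipticCurves`. Sibling **proof file** (theorems only; D-0014 append
protocol) of `ZetaEllipticCurveFiniteField`, which vendors Silverman, *AEC*, Thm. V.2.3.1(a) as
the named fact `WeierstrassCurve.card_point_baseChange_eq W`: for an elliptic curve `E / 𝔽_q`
(`W` over the finite field `k`, `q = #k`), `a = q + 1 - #E(𝔽_q)` and `α, β ∈ ℂ` with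
`α + β = a`, `αβ = q` ("the roots of `T² - aT + q`"), `α` and `β` are complex conjugates with
`|α| = |β| = √q`, and `#E(K) = q^[K:k] + 1 - α^[K:k] - β^[K:k]` for every finite extension field
`K ⊇ k` (held text: `book:silverman1986-arithmetic-elliptic-curves`, 2nd-edition numbering,
Thm. V.2.3.1, PDF pp. 139–140). Here it is **proved**:
`WeierstrassCurve.card_point_baseChange_eq_holds`. It is the leaf `hHW` of the assembly
`Literature.NumberTheory.EllipticCurves.FunctionField.hasLContinuation_of_functionField_of_facts` of
`FunctionFieldEllipticLRationality` (Ulmer 2011, Lecture 1, §9: the `L`-function of a constant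
elliptic curve over a global function field, Exercise 9.2).

## The proof (elementary; the source argues on the Tate module)

Silverman proves (a) from `det φ_ℓ = deg φ = q`, `tr φ_ℓ = a` on `T_ℓ E` (III.8.6, Weil pairing)
and `#E(𝔽_{qⁿ}) = deg(1 - φⁿ) = det(1 - φ_ℓⁿ)`, putting `φ_ℓ` in Jordan form. The tree instead
*proves* part (b), `φ² - aφ + q = 0`, by Manin's elementary method
(`WeierstrassCurve.frobenius_sq_sub_trace_smul_add_card_smul` of `FrobeniusManinProofs`:
`σ_q² T - a • σ_q T + q • T = O` for every `T ∈ E(k̄)`, `σ_q ∈ Γ_k` the arithmetic Frobenius),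
and (a) follows from (b) applied twice, without `ℓ`-adic input:

1. *Power sums* (`exists_int_pow_add_pow_eq`, `X_sq_sub_dvd_of_pow_add_pow_eq`; Silverman
   Exercise 5.13, PDF pp. 149–150: `a_{n+2} = a_1 a_{n+1} - q a_n`, `a_0 = 2`). The integers
   `s_n` with `s_0 = 2`, `s_1 = a`, `s_{m+2} = a s_{m+1} - q s_m` satisfy `αⁿ + βⁿ = s_n` in every
   commutative ring in which `α + β = a`, `αβ = q`; in particular in `ℂ`, and in
   `ℤ[T]/(T² - aT + q)` with `α = t`, `β = a - t`, whence `T² - aT + q ∣ T²ⁿ - s_n Tⁿ + qⁿ`.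
2. *On `E(k̄)`* (`iterate_sub_smul_iterate_add_smul_eq_zero`): evaluating at the additive
   endomorphism `σ_q` of `E(k̄)`, (b) gives `σ_q²ⁿ T - s_n • σ_qⁿ T + qⁿ • T = O`.
3. *Over `K`, `[K : k] = n`* (`frobenius_pow_sq_sub_trace_smul_add_card_smul`): (b) for the
   elliptic curve `E_K = E ×_k K` over the finite field `K` (`#K = qⁿ`) reads
   `σ² T' - a_K • σ T' + qⁿ • T' = O` on `E_K(K̄)`, `σ = σ_{qⁿ} ∈ Γ_K`, `a_K = qⁿ + 1 - #E(K)`.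
   Along a `k`-isomorphism `e : K̄ ≅ k̄` of algebraic closures of `k` (Mathlib's
   `IsAlgClosure.equiv`; `K̄` is one since `K / k` is algebraic) the coordinatewise map
   `E_K(K̄) = E(K̄) → E(k̄)` is a bijective homomorphism carrying `σ_{qⁿ}` to `σ_qⁿ` (both raise
   coordinates to the `qⁿ`-th power; `map_frobenius_smul_geomPoints`), so
   `σ_q²ⁿ T - a_K • σ_qⁿ T + qⁿ • T = O` on `E(k̄)`.
4. *Comparison* (`tr_baseChange_eq_of_pow_add_pow_eq`): subtracting, `(s_n - a_K) • σ_qⁿ T = O`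
   for all `T`, i.e. the integer `s_n - a_K` annihilates `E(k̄)`; but `E(k̄)[N]` is finite for
   `N ≠ 0` (Silverman Cor. III.6.4, the tree's `WeierstrassCurve.finite_torsionPoints_holds`)
   while `E(k̄)` is infinite (`WeierstrassCurve.infinite_point`), so `a_K = s_n = αⁿ + βⁿ`
   (`eq_zero_of_forall_zsmul_geomPoints_eq_zero`), i.e. `#E(K) = qⁿ + 1 - αⁿ - βⁿ`.
5. *Absolute values* (`conj_eq_and_normSq_eq_of_sq_le`): Hasse's bound `a² ≤ 4q` (the tree's
   `Literature.NumberTheory.EllipticCurves.HasseManin.abs_card_sub_le`, Silverman V.1.1) gives `(α - β)² = a² - 4q ≤ 0`, so `α - β`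
   is purely imaginary, `β = conj α` and `|α|² = αβ = q` (the source's "nonnegative quadratic"
   argument, PDF p. 140, with Hasse's theorem supplying nonnegativity).

## Contents (all proved; no definitions)

* `WeierstrassCurve.exists_int_pow_add_pow_eq`, `X_sq_sub_dvd_of_pow_add_pow_eq`,
  `iterate_sub_smul_iterate_add_smul_eq_zero` (power sums, step 1–2);
* `conj_eq_and_normSq_eq_of_sq_le` (step 5);
* `eq_zero_of_forall_zsmul_geomPoints_eq_zero` (no nonzero integer kills `E(k̄)`);
* `pow_smul_eq_pow_card_pow`, `map_frobenius_smul_geomPoints`,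
  `frobenius_pow_sq_sub_trace_smul_add_card_smul` (step 3);
* `tr_baseChange_eq_of_pow_add_pow_eq`, `natCard_point_baseChange_eq_of_pow_add_pow_eq`
  (step 4: `a_K = s_n`, `#E(K) = qⁿ + 1 - s_n`);
* `card_point_baseChange_eq_holds` — the discharge.

Relies on (all theorems of the tree): `WeierstrassCurve.frobenius_sq_sub_trace_smul_add_card_smul`
(`FrobeniusManinProofs`), `Literature.NumberTheory.EllipticCurves.HasseManin.abs_card_sub_le` (`HasseManin`),
`WeierstrassCurve.exists_frobenius_absoluteGaloisGroup` (`FrobeniusTateModule`),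
`WeierstrassCurve.finite_torsionPoints_holds` (`GaloisActionProofs`),
`WeierstrassCurve.infinite_point` (`DivisionPolynomialTorsion`); Mathlib: `IsAlgClosure.equiv`,
`IsAlgClosure.ofAlgebraic`, `AdjoinRoot.mk_eq_zero`, `Module.natCard_eq_pow_finrank`.

## Design notes

* Theorems only, `namespace WeierstrassCurve` (dot-notation extensions, as in the files it
  serves); `open scoped Classical` as in `GaloisAction` so that the group structures on
  `geomPoints` agree syntactically.
* The transport of step 3 uses that `(W.baseChange K).baseChange K̄ = W.baseChange K̄` and hence
  `(W.baseChange K).geomPoints = (W.baseChange K̄).toAffine.Point` hold *definitionally*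
  (`WeierstrassCurve.map_map` is `rfl`), so points of `E_K(K̄)` are fed to Mathlib's
  `WeierstrassCurve.Affine.Point.map (W' := W)` through `show` casts; no transport structure is
  defined.
* `exists_int_pow_add_pow_eq` quantifies over rings in a fixed universe inside an existential;
  it is used at universe `0` (`ℂ` and `AdjoinRoot` over `ℤ`).
* `card_point_baseChange_eq_holds` is stated for `k : Type`, matching the fact.

## References

* [SilvermanAEC2009] J. H. Silverman, *The Arithmetic of Elliptic Curves*, 2nd ed., GTM 106,
  Springer 2009: Thm. V.2.3.1(a),(b) and proof (PDF pp. 139–140 of the held text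
  `book:silverman1986-arithmetic-elliptic-curves`), Thm. V.1.1 (Hasse), Cor. III.6.4,
  Exercise 5.13 (pp. 149–150).
* [Ulmer2011ParkCity] D. Ulmer, *Elliptic curves over function fields*, IAS/Park City Math.
  Ser. 18 (2011), Lecture 0, §3 and Lecture 1, Exercise 9.2 (arXiv:1101.1939) — the consumer.
* Yu. I. Manin, *On cubic congruences to a prime modulus*, Izv. Akad. Nauk SSSR 20 (1956) — the
  elementary proof of V.2.3.1(b) used by the tree.
-/

noncomputable section

open scoped Classical
open Polynomial

universe u

namespace WeierstrassCurve

/-! ## Power sums `s_n = αⁿ + βⁿ` of the roots of `T² - aT + q` -/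

section PowerSums

/-- For integers `a, q` and every `n` there are integers `c = s_n`, `d = s_{n+1}` such that in
every commutative ring, `α + β = a` and `αβ = q` imply `αⁿ + βⁿ = c` and `αⁿ⁺¹ + βⁿ⁺¹ = d`
(Newton–Girard: `s_0 = 2`, `s_1 = a`, `s_{m+2} = a s_{m+1} - q s_m`; for the Frobenius roots this
is Silverman's Exercise 5.13, `a_{n+2} = a_1 a_{n+1} - q a_n`). [cite: SilvermanAEC2009, Exercise 5.13] -/
theorem exists_int_pow_add_pow_eq (a q : ℤ) (n : ℕ) :
    ∃ c d : ℤ, ∀ {S : Type u} [CommRing S] (α β : S), α + β = a → α * β = q →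
      α ^ n + β ^ n = c ∧ α ^ (n + 1) + β ^ (n + 1) = d := by
  induction n with
  | zero =>
    exact ⟨2, a, fun α β h1 _ => ⟨by norm_num, by simpa using h1⟩⟩
  | succ n ih =>
    obtain ⟨c, d, h⟩ := ih
    refine ⟨d, a * d - q * c, fun α β h1 h2 => ?_⟩
    obtain ⟨hc, hd⟩ := h α β h1 h2
    refine ⟨hd, ?_⟩
    have e : α ^ (n + 1 + 1) + β ^ (n + 1 + 1) =
        (α + β) * (α ^ (n + 1) + β ^ (n + 1)) - α * β * (α ^ n + β ^ n) := by ring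
    rw [e, h1, h2, hc, hd]
    push_cast
    ring

/-- If `αⁿ + βⁿ = c` whenever `α + β = a`, `αβ = q` (in every commutative ring), then
`T² - aT + q` divides `T²ⁿ - c Tⁿ + qⁿ` in `ℤ[T]` (evaluate at the universal root `t` of
`ℤ[T]/(T² - aT + q)`: with `t' = a - t`, `t²ⁿ - (tⁿ + t'ⁿ) tⁿ + (t t')ⁿ = 0`). [folklore] -/
theorem X_sq_sub_dvd_of_pow_add_pow_eq {a q c : ℤ} {n : ℕ}
    (hc : ∀ {S : Type} [CommRing S] (α β : S), α + β = a → α * β = q → α ^ n + β ^ n = c) :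
    (X ^ 2 - C a * X + C q : ℤ[X]) ∣ X ^ (2 * n) - C c * X ^ n + C (q ^ n) := by
  set f : ℤ[X] := X ^ 2 - C a * X + C q with hf
  rw [← AdjoinRoot.mk_eq_zero]
  set t : AdjoinRoot f := AdjoinRoot.root f with ht_def
  have ht : t ^ 2 - (a : AdjoinRoot f) * t + q = 0 := by
    have h0 : AdjoinRoot.mk f f = 0 := AdjoinRoot.mk_self
    simpa [hf, map_sub, map_add, map_mul, map_pow, AdjoinRoot.mk_X, AdjoinRoot.mk_C] using h0
  have h1 : t + ((a : AdjoinRoot f) - t) = a := by ring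
  have h2 : t * ((a : AdjoinRoot f) - t) = q := by linear_combination -ht
  have hs := hc t _ h1 h2
  have e : AdjoinRoot.mk f (X ^ (2 * n) - C c * X ^ n + C (q ^ n)) =
      t ^ (2 * n) - (c : AdjoinRoot f) * t ^ n + (q : AdjoinRoot f) ^ n := by
    simp [map_sub, map_add, map_mul, map_pow, AdjoinRoot.mk_X, ht_def]
  rw [e, ← hs, ← h2, mul_pow]
  ring

/-- If an additive endomorphism `φ` satisfies `φ² - aφ + q = 0` pointwise, then
`φ²ⁿ - s_n φⁿ + qⁿ = 0` pointwise for the power sums `s_n` (through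
`T² - aT + q ∣ T²ⁿ - s_n Tⁿ + qⁿ`, evaluated at `φ` in `End(G)`). [folklore] -/
theorem iterate_sub_smul_iterate_add_smul_eq_zero {G : Type*} [AddCommGroup G] (φ : G →+ G)
    {a q c : ℤ} {n : ℕ} (hφ : ∀ T, φ (φ T) - a • φ T + q • T = 0)
    (hdiv : (X ^ 2 - C a * X + C q : ℤ[X]) ∣ X ^ (2 * n) - C c * X ^ n + C (q ^ n)) (T : G) :
    φ^[2 * n] T - c • φ^[n] T + q ^ n • T = 0 := by
  set ψ : Module.End ℤ G := φ.toIntLinearMap with hψ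
  have hf : aeval ψ (X ^ 2 - C a * X + C q : ℤ[X]) = 0 := by
    ext T'
    simpa [hψ, sq, Module.algebraMap_end_apply] using hφ T'
  obtain ⟨g, hg⟩ := hdiv
  have h0 : aeval ψ (X ^ (2 * n) - C c * X ^ n + C (q ^ n) : ℤ[X]) = 0 := by
    rw [hg, map_mul, hf, zero_mul]
  have h1 := LinearMap.congr_fun h0 T
  have hiter : ∀ m (T : G), (ψ ^ m) T = φ^[m] T := fun m T => by
    rw [Module.End.pow_apply]
    rfl
  simpa only [map_add, map_sub, map_mul, aeval_C, aeval_X_pow, LinearMap.add_apply,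
    LinearMap.sub_apply, LinearMap.zero_apply, Module.End.mul_apply, Module.algebraMap_end_apply,
    hiter] using h1

end PowerSums

/-! ## Complex roots of `T² - aT + q` under Hasse's bound -/

section Roots

/-- If `α + β = a` and `αβ = q` with `a, q` real and `a² ≤ 4q`, then `β = conj α` and `|α|² = q`
(`(α - β)² = a² - 4q ≤ 0`, so `α - β` is purely imaginary). [folklore] -/
theorem conj_eq_and_normSq_eq_of_sq_le {a q : ℝ} {α β : ℂ} (h1 : α + β = a) (h2 : α * β = q)
    (h : a ^ 2 ≤ 4 * q) : starRingEnd ℂ α = β ∧ Complex.normSq α = q := by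
  set D : ℝ := 4 * q - a ^ 2 with hD
  have hD0 : 0 ≤ D := by linarith
  set δ : ℂ := α - β with hδ_def
  have hw : (Complex.I * (Real.sqrt D : ℂ)) ^ 2 = -(D : ℂ) := by
    rw [mul_pow, Complex.I_sq, ← Complex.ofReal_pow, Real.sq_sqrt hD0]
    ring
  have hδ : δ ^ 2 = (Complex.I * (Real.sqrt D : ℂ)) ^ 2 := by
    have e : δ ^ 2 = (α + β) ^ 2 - 4 * (α * β) := by rw [hδ_def]; ring
    rw [hw, e, h1, h2, hD]
    push_cast
    ring
  have hconjδ : starRingEnd ℂ δ = -δ := by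
    rcases sq_eq_sq_iff_eq_or_eq_neg.mp hδ with h' | h'
    · rw [h', map_mul, Complex.conj_I, Complex.conj_ofReal]; ring
    · rw [h', map_neg, map_mul, Complex.conj_I, Complex.conj_ofReal]; ring
  have hα : α = ((a : ℂ) + δ) / 2 := by
    rw [hδ_def, ← h1]; ring
  have hβ : β = ((a : ℂ) - δ) / 2 := by
    rw [hδ_def, ← h1]; ring
  have hconj : starRingEnd ℂ α = β := by
    rw [hα, hβ, map_div₀, map_add, Complex.conj_ofReal, hconjδ, map_ofNat]
    ring
  refine ⟨hconj, ?_⟩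
  have e : (Complex.normSq α : ℂ) = q := by
    rw [← Complex.mul_conj, hconj, h2]
  exact_mod_cast e

end Roots

/-! ## No nonzero integer kills `E(k̄)` -/

section Torsion

variable {k : Type u} [Field k] (W : WeierstrassCurve k) [W.IsElliptic]

/-- For an elliptic curve `E / k`, the group `E(k̄)` is not annihilated by any nonzero integer:
`E(k̄)[N]` is finite (Silverman, *AEC*, Cor. III.6.4, the tree's `finite_torsionPoints_holds`)
while `E(k̄)` is infinite (`infinite_point`). [cite: SilvermanAEC2009, Cor. III.6.4] -/
theorem eq_zero_of_forall_zsmul_geomPoints_eq_zero {N : ℤ} (h : ∀ T : W.geomPoints, N • T = 0) :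
    N = 0 := by
  by_contra hN
  haveI : Finite (torsionPoints W (AlgebraicClosure k) N) :=
    finite_torsionPoints_holds W (AlgebraicClosure k) hN
  haveI : Infinite W.geomPoints := infinite_point (V := W.baseChange (AlgebraicClosure k))
  have hfin : Finite W.geomPoints :=
    Finite.of_surjective
      (fun P : torsionPoints W (AlgebraicClosure k) N => (show W.geomPoints from P.1))
      fun T => ⟨⟨T, (mem_torsionPoints_iff W _ T).mpr (h T)⟩, rfl⟩
  exact not_finite W.geomPoints

end Torsion

/-! ## The Frobenius over a finite extension, transported to `E(k̄)` -/

section Frobenius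

variable {k : Type u} [Field k] [Fintype k] (W : WeierstrassCurve k)

/-- `σ_q ^ m` acts on `k̄` by `x ↦ x ^ (q ^ m)`. [folklore] -/
theorem pow_smul_eq_pow_card_pow {σ : Field.absoluteGaloisGroup k}
    (hσ : ∀ x : AlgebraicClosure k, σ • x = x ^ Nat.card k) (m : ℕ) (x : AlgebraicClosure k) :
    σ ^ m • x = x ^ (Nat.card k ^ m) := by
  induction m with
  | zero => simp
  | succ m ih => rw [pow_succ, mul_smul, hσ, smul_pow', ih, ← pow_mul, ← pow_succ]

variable (K : Type u) [Field K] [Fintype K] [Algebra k K]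

/-- Transport of the Frobenius: along a `k`-embedding `e : K̄ → k̄` of algebraic closures, the
arithmetic Frobenius `σ_{qⁿ}` of the degree-`n` extension `K / k` acting on `E(K̄)` becomes
`σ_q ^ n` acting on `E(k̄)` (both raise coordinates to the power `qⁿ`). [folklore] -/
theorem map_frobenius_smul_geomPoints (e : AlgebraicClosure K →ₐ[k] AlgebraicClosure k)
    {σ : Field.absoluteGaloisGroup k} (hσ : ∀ x : AlgebraicClosure k, σ • x = x ^ Nat.card k)
    {σK : Field.absoluteGaloisGroup K} (hσK : ∀ x : AlgebraicClosure K, σK • x = x ^ Nat.card K)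
    (T' : (W.baseChange K).geomPoints) :
    Affine.Point.map (W' := W) e
        (show (W.baseChange (AlgebraicClosure K)).toAffine.Point from σK • T') =
      σ ^ Module.finrank k K •
        (show W.geomPoints from Affine.Point.map (W' := W) e
          (show (W.baseChange (AlgebraicClosure K)).toAffine.Point from T')) := by
  change ((W.baseChange K).baseChange (AlgebraicClosure K)).toAffine.Point at T'
  rcases T' with _ | ⟨x, y, h⟩
  · rfl
  · have e1 : σK • (show (W.baseChange K).geomPoints from Affine.Point.some x y h) =
        Affine.Point.map ((show AlgebraicClosure K ≃ₐ[K] AlgebraicClosure K from σK) :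
          AlgebraicClosure K →ₐ[K] AlgebraicClosure K) (.some x y h) := rfl
    have hx : e ((show AlgebraicClosure K ≃ₐ[K] AlgebraicClosure K from σK) x) =
        (show AlgebraicClosure k ≃ₐ[k] AlgebraicClosure k from σ ^ Module.finrank k K) (e x) := by
      change e (σK • x) = σ ^ Module.finrank k K • e x
      rw [hσK, map_pow, pow_smul_eq_pow_card_pow hσ, Module.natCard_eq_pow_finrank (K := k) (V := K)]
    have hy : e ((show AlgebraicClosure K ≃ₐ[K] AlgebraicClosure K from σK) y) =
        (show AlgebraicClosure k ≃ₐ[k] AlgebraicClosure k from σ ^ Module.finrank k K) (e y) := by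
      change e (σK • y) = σ ^ Module.finrank k K • e y
      rw [hσK, map_pow, pow_smul_eq_pow_card_pow hσ, Module.natCard_eq_pow_finrank (K := k) (V := K)]
    change Affine.Point.map (W' := W) e (Affine.Point.map
        ((show AlgebraicClosure K ≃ₐ[K] AlgebraicClosure K from σK) :
          AlgebraicClosure K →ₐ[K] AlgebraicClosure K) (.some x y h)) =
      Affine.Point.map ((show AlgebraicClosure k ≃ₐ[k] AlgebraicClosure k from σ ^ Module.finrank k K) :
          AlgebraicClosure k →ₐ[k] AlgebraicClosure k) (Affine.Point.map (W' := W) e (.some x y h))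
    simp only [Affine.Point.map_some, Affine.Point.some.injEq]
    exact ⟨hx, hy⟩

variable [W.IsElliptic]

/-- **`π_K = π ^ n` satisfies `π_K² - a_K π_K + qⁿ = 0` on `E(k̄)`.** For a degree-`n` extension
`K / k` of finite fields, the relation `σ² - a_K σ + #K = 0` of the `#K`-power Frobenius of
`E_K = E ×_k K` on `E_K(K̄)` (`frobenius_sq_sub_trace_smul_add_card_smul`, with
`a_K = #K + 1 - #E(K)`), transported to `E(k̄)` along an isomorphism `K̄ ≅ k̄` of algebraic
closures of `k`, under which the Frobenius of `K` becomes `σ_q ^ n`.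
[cite: SilvermanAEC2009, Thm. V.2.3.1(b)] -/
theorem frobenius_pow_sq_sub_trace_smul_add_card_smul {σ : Field.absoluteGaloisGroup k}
    (hσ : ∀ x : AlgebraicClosure k, σ • x = x ^ Nat.card k) (T : W.geomPoints) :
    σ ^ Module.finrank k K • σ ^ Module.finrank k K • T
      - Literature.NumberTheory.EllipticCurves.HasseManin.tr (W.baseChange K) • σ ^ Module.finrank k K • T
      + (Fintype.card K : ℤ) • T = 0 := by
  obtain ⟨σK, hσK⟩ := exists_frobenius_absoluteGaloisGroup K
  haveI : Module.Finite k K := Module.Finite.of_finite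
  haveI : Algebra.IsAlgebraic k K := Algebra.IsAlgebraic.of_finite k K
  haveI : IsAlgClosure k (AlgebraicClosure K) := IsAlgClosure.ofAlgebraic k K (AlgebraicClosure K)
  set e : AlgebraicClosure K ≃ₐ[k] AlgebraicClosure k :=
    IsAlgClosure.equiv k (AlgebraicClosure K) (AlgebraicClosure k) with he
  set Ψ : (W.baseChange K).geomPoints →+ W.geomPoints :=
    (show (W.baseChange K).geomPoints →+ W.geomPoints from
      Affine.Point.map (W' := W) (e : AlgebraicClosure K →ₐ[k] AlgebraicClosure k)) with hΨ
  have hΨσ : ∀ T' : (W.baseChange K).geomPoints,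
      Ψ (σK • T') = σ ^ Module.finrank k K • Ψ T' := fun T' =>
    map_frobenius_smul_geomPoints W K (e : AlgebraicClosure K →ₐ[k] AlgebraicClosure k) hσ hσK T'
  have hsurj : Function.Surjective Ψ := by
    intro T
    refine ⟨show (W.baseChange K).geomPoints from
      Affine.Point.map (W' := W) (e.symm : AlgebraicClosure k →ₐ[k] AlgebraicClosure K)
        (show (W.baseChange (AlgebraicClosure k)).toAffine.Point from T), ?_⟩
    change Affine.Point.map (W' := W) (e : AlgebraicClosure K →ₐ[k] AlgebraicClosure k)
      (Affine.Point.map (W' := W) (e.symm : AlgebraicClosure k →ₐ[k] AlgebraicClosure K) _) = T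
    rw [Affine.Point.map_map]
    change (W.baseChange (AlgebraicClosure k)).toAffine.Point at T
    rcases T with _ | ⟨x, y, h⟩
    · rfl
    · rw [Affine.Point.map_some, Affine.Point.some.injEq]
      exact ⟨e.apply_symm_apply x, e.apply_symm_apply y⟩
  obtain ⟨T', rfl⟩ := hsurj T
  have h := frobenius_sq_sub_trace_smul_add_card_smul (W.baseChange K) hσK T'
  have h' := congrArg Ψ h
  simp only [map_zero, map_add, map_sub, map_zsmul, hΨσ] at h'
  exact h'

/-- **The trace of Frobenius over `𝔽_{qⁿ}` is the power sum `s_n`** (Silverman, *AEC*,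
Thm. V.2.3.1(a), core): if `s_n ∈ ℤ` is the `n`-th power sum of the roots of `T² - aT + q`
(`a = q + 1 - #E(k)`), then `a_K := #K + 1 - #E(K) = s_n` for every extension `K / k` of degree
`n`. Proof: on `E(k̄)`, `π² - aπ + q = 0` (Manin, `frobenius_sq_sub_trace_smul_add_card_smul`)
gives `π²ⁿ - s_n πⁿ + qⁿ = 0`, while `π_K = πⁿ` gives `π²ⁿ - a_K πⁿ + qⁿ = 0`
(`frobenius_pow_sq_sub_trace_smul_add_card_smul`); subtracting, the integer `s_n - a_K` kills
the infinite group `E(k̄)`, whose torsion subgroups are finite, so it vanishes.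
[cite: SilvermanAEC2009, Thm. V.2.3.1(a)] -/
theorem tr_baseChange_eq_of_pow_add_pow_eq {c : ℤ}
    (hc : ∀ {S : Type} [CommRing S] (α β : S), α + β = Literature.NumberTheory.EllipticCurves.HasseManin.tr W →
      α * β = (Fintype.card k : ℤ) → α ^ Module.finrank k K + β ^ Module.finrank k K = c) :
    Literature.NumberTheory.EllipticCurves.HasseManin.tr (W.baseChange K) = c := by
  obtain ⟨σ, hσ⟩ := exists_frobenius_absoluteGaloisGroup k
  set n := Module.finrank k K with hn
  have hdiv := X_sq_sub_dvd_of_pow_add_pow_eq hc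
  -- `π² - aπ + q = 0` on `E(k̄)`, as an additive endomorphism
  set φ : W.geomPoints →+ W.geomPoints := DistribSMul.toAddMonoidHom W.geomPoints σ with hφ
  have hφ1 : ∀ T, φ (φ T) - Literature.NumberTheory.EllipticCurves.HasseManin.tr W • φ T + (Fintype.card k : ℤ) • T = 0 := fun T =>
    frobenius_sq_sub_trace_smul_add_card_smul W hσ T
  have hiter : ∀ m (T : W.geomPoints), φ^[m] T = σ ^ m • T := fun m => by
    induction m with
    | zero => intro T; simp
    | succ m ih =>
      intro T
      rw [Function.iterate_succ_apply', ih, pow_succ', mul_smul]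
      rfl
  have hk : ∀ T : W.geomPoints,
      σ ^ n • σ ^ n • T - c • σ ^ n • T + (Fintype.card k : ℤ) ^ n • T = 0 := fun T => by
    have h := iterate_sub_smul_iterate_add_smul_eq_zero φ hφ1 hdiv T
    rw [hiter, hiter] at h
    rw [← mul_smul, ← pow_add, ← two_mul]
    exact h
  have hK := frobenius_pow_sq_sub_trace_smul_add_card_smul W K hσ
  have hcardK : (Fintype.card K : ℤ) = (Fintype.card k : ℤ) ^ n := by
    rw [Module.card_eq_pow_finrank (K := k) (V := K)]; push_cast; rfl
  have hkill : ∀ T : W.geomPoints, (c - Literature.NumberTheory.EllipticCurves.HasseManin.tr (W.baseChange K)) • T = 0 := by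
    intro T
    have h1 := hk ((σ ^ n)⁻¹ • T)
    have h2 := hK ((σ ^ n)⁻¹ • T)
    rw [hcardK] at h2
    rw [smul_inv_smul] at h1 h2
    have e3 : (c - Literature.NumberTheory.EllipticCurves.HasseManin.tr (W.baseChange K)) • T =
        (σ ^ n • T - Literature.NumberTheory.EllipticCurves.HasseManin.tr (W.baseChange K) • T +
            (Fintype.card k : ℤ) ^ n • (σ ^ n)⁻¹ • T) -
          (σ ^ n • T - c • T + (Fintype.card k : ℤ) ^ n • (σ ^ n)⁻¹ • T) := by
      rw [sub_smul]; abel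
    rw [e3, h1, h2, sub_zero]
  have := eq_zero_of_forall_zsmul_geomPoints_eq_zero W hkill
  linarith

/-- **Silverman, *AEC*, Thm. V.2.3.1(a), point counts:** with `s_n` as above,
`#E(K) = qⁿ + 1 - s_n` for every extension `K / k` of degree `n` (`#K = qⁿ`).
[cite: SilvermanAEC2009, Thm. V.2.3.1(a)] -/
theorem natCard_point_baseChange_eq_of_pow_add_pow_eq {c : ℤ}
    (hc : ∀ {S : Type} [CommRing S] (α β : S), α + β = Literature.NumberTheory.EllipticCurves.HasseManin.tr W →
      α * β = (Fintype.card k : ℤ) → α ^ Module.finrank k K + β ^ Module.finrank k K = c) :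
    (Nat.card (W.baseChange K).toAffine.Point : ℤ) =
      (Fintype.card k : ℤ) ^ Module.finrank k K + 1 - c := by
  have h := tr_baseChange_eq_of_pow_add_pow_eq W K hc
  rw [Literature.NumberTheory.EllipticCurves.HasseManin.tr, Module.card_eq_pow_finrank (K := k) (V := K)] at h
  push_cast at h
  linarith

end Frobenius

/-! ## Silverman V.2.3.1(a), discharged -/

/-- **Discharge of `WeierstrassCurve.card_point_baseChange_eq`** (Silverman, *AEC*,
Thm. V.2.3.1(a); Hasse–Weil for elliptic curves over finite fields): for `E / 𝔽_q` elliptic,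
`a = q + 1 - #E(𝔽_q)` and `α, β ∈ ℂ` with `α + β = a`, `αβ = q`: `β = conj α`,
`|α| = |β| = √q`, and `#E(K) = q^[K:k] + 1 - α^[K:k] - β^[K:k]` for every finite extension
`K / k`. Proof: `|α| = |β| = √q` from Hasse's bound `a² ≤ 4q` (the tree's
`Literature.NumberTheory.EllipticCurves.HasseManin.abs_card_sub_le`, Manin's elementary proof) by `conj_eq_and_normSq_eq_of_sq_le`;
the point counts by `natCard_point_baseChange_eq_of_pow_add_pow_eq` (the relation
`π² - aπ + q = 0` in `End(E)`, V.2.3.1(b), proved in the tree by Manin's method, in place of the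
`ℓ`-adic argument of the source). [cite: SilvermanAEC2009, Thm. V.2.3.1(a)] -/
theorem card_point_baseChange_eq_holds {k : Type} [Field k] [Fintype k] (W : WeierstrassCurve k) :
    W.card_point_baseChange_eq := by
  intro _ α β hsum hprod
  -- Hasse: a² ≤ 4q
  have hH := Literature.NumberTheory.EllipticCurves.HasseManin.abs_card_sub_le W
  set a : ℤ := Literature.NumberTheory.EllipticCurves.HasseManin.tr W with ha_def
  have ha : (((Fintype.card k : ℤ) + 1 - (Nat.card W.toAffine.Point : ℤ) : ℤ) : ℂ) = ((a : ℝ) : ℂ) := by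
    rw [ha_def, Literature.NumberTheory.EllipticCurves.HasseManin.tr]; push_cast; ring
  rw [ha] at hsum
  have hprod' : α * β = ((Fintype.card k : ℝ) : ℂ) := by rw [hprod]; push_cast; rfl
  have hsq : (a : ℝ) ^ 2 ≤ 4 * (Fintype.card k : ℝ) := by
    have e : (a : ℝ) = -((Nat.card W.toAffine.Point : ℝ) - ((Fintype.card k : ℝ) + 1)) := by
      rw [ha_def, Literature.NumberTheory.EllipticCurves.HasseManin.tr]; push_cast; ring
    have h0 : (0 : ℝ) ≤ Fintype.card k := Nat.cast_nonneg _
    have h1 : |(a : ℝ)| ≤ 2 * Real.sqrt (Fintype.card k) := by rw [e, abs_neg]; exact hH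
    have h2 : (a : ℝ) ^ 2 = |(a : ℝ)| ^ 2 := (sq_abs _).symm
    rw [h2]
    calc |(a : ℝ)| ^ 2 ≤ (2 * Real.sqrt (Fintype.card k)) ^ 2 :=
          pow_le_pow_left₀ (abs_nonneg _) h1 2
      _ = 4 * Fintype.card k := by rw [mul_pow, Real.sq_sqrt h0]; norm_num
  obtain ⟨hconj, hnorm⟩ := conj_eq_and_normSq_eq_of_sq_le hsum hprod' hsq
  have hα : ‖α‖ = √(Fintype.card k : ℝ) := by
    rw [Complex.norm_def, hnorm]
  have hβ : ‖β‖ = √(Fintype.card k : ℝ) := by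
    rw [← hconj, Complex.norm_conj, hα]
  refine ⟨hconj, hα, hβ, fun K _ _ _ => ?_⟩
  -- the power sum `s_n`
  obtain ⟨c, d, hc⟩ := exists_int_pow_add_pow_eq.{0} a (Fintype.card k) (Module.finrank k K)
  have hc' : ∀ {S : Type} [CommRing S] (α β : S), α + β = Literature.NumberTheory.EllipticCurves.HasseManin.tr W →
      α * β = (Fintype.card k : ℤ) →
        α ^ Module.finrank k K + β ^ Module.finrank k K = c :=
    fun α β h1 h2 => (hc α β h1 h2).1
  have hcount := natCard_point_baseChange_eq_of_pow_add_pow_eq W K hc'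
  have hsumZ : α + β = (a : ℂ) := by rw [hsum]; push_cast; rfl
  have hprodZ : α * β = ((Fintype.card k : ℤ) : ℂ) := by rw [hprod]; push_cast; rfl
  have hcC := (hc α β hsumZ hprodZ).1
  have e : (Nat.card (W.baseChange K).toAffine.Point : ℂ) =
      (Fintype.card k : ℂ) ^ Module.finrank k K + 1 - (c : ℂ) := by exact_mod_cast hcount
  rw [e, ← hcC]
  ring

end WeierstrassCurve

end
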